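import Mathlib
import HarnessLib
import Literature.MathematicalPhysics.StatisticalMechanics.MuGSC
import Literature.MathematicalPhysics.StatisticalMechanics.LennardJonesClusters
import Summits.AtomisticToContinuum.Crystallization.Theses.OverbindingBudget
import Summits.AtomisticToContinuum.Crystallization.Theorems.OverbindingBudgetCubeBookkeeping
import Summits.AtomisticToContinuum.Crystallization.Theorems.OverbindingBudgetCubeChargeLaw

/-!
# OverbindingBudget — the engine of the `RobustDefectLimitWindows` line «Coercivity» (stmt-AtomisticToContinuum-31280)

Registered stub `stub_excessInstability` (skeleton `Cruxes/RobustDefectLimitWindows/Lines/birth.lean`, composition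
`RobustDefectLimitWindows_of`): in a μGSC(e) `Y ⊆ ℝ³` whose large cubes hold more than `5/4 ℓ³` points, no
`κ > 0` can be an energy EXCESS on all large cubes, `(e + κ)·#F ≤ ½ ∑_{F×F} V_LJ`: the μ-stability removal test
(`stub_removalUpperBound`: `½∑_{F×F} V_LJ + X ≤ e·#F`, `X` = cross field) would give `κ·#F ≤ −X ≤ κ ℓ³`
(`stub_crossTermSmall` with `η = κ`), contradicting `#F > 5/4 ℓ³`.
So the crux `RobustDefectLimitWindows` is reduced to COERCIVITY (`stub_robustCoercivity`: robust syndetic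
gapped-twelve violators force a `κ`-excess on large cubes).
-/

namespace Summit.AtomisticToContinuum.Crystallization.Theorems.OverbindingBudgetExcessInstability

open Literature.MathematicalPhysics.StatisticalMechanics
open Summit.AtomisticToContinuum.Crystallization.Theorems.OverbindingBudgetCubeBookkeeping (stub_removalUpperBound)
open Summit.AtomisticToContinuum.Crystallization.Theorems.OverbindingBudgetCubeChargeLaw (stub_crossTermSmall)

/-- A half-open cube `Q(c, ℓ)` lies in the closed ball `B(c, 3ℓ)`; hence a uniformly discrete set meets it in a
finite set. [folklore] -/
theorem finite_inter_cube {Y : Set (EuclideanSpace ℝ (Fin 3))} (hUD : UniformlyDiscrete Y) (c : EuclideanSpace ℝ (Fin 3)) {ℓ : ℝ} (hℓ : 0 ≤ ℓ) :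
    (Y ∩ {z | ∀ i : Fin 3, c i ≤ z i ∧ z i < c i + ℓ}).Finite := by
  refine (hUD.finite_inter_closedBall c (3 * ℓ)).subset ?_
  rintro z ⟨hzY, hz⟩
  refine ⟨hzY, ?_⟩
  rw [Metric.mem_closedBall, EuclideanSpace.dist_eq]
  have hi : ∀ i, dist (z i) (c i) ^ 2 ≤ ℓ ^ 2 := by
    intro i
    rw [Real.dist_eq]
    have h := hz i
    have habs : |z i - c i| ≤ ℓ := by
      rw [abs_le]; constructor <;> linarith [h.1, h.2]
    nlinarith [abs_nonneg (z i - c i)]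
  calc √(∑ i, dist (z i) (c i) ^ 2) ≤ √(∑ _i : Fin 3, ℓ ^ 2) :=
        Real.sqrt_le_sqrt (Finset.sum_le_sum (fun i _ => hi i))
    _ = √(3 * ℓ ^ 2) := by simp
    _ ≤ √((3 * ℓ) ^ 2) := Real.sqrt_le_sqrt (by nlinarith)
    _ = 3 * ℓ := Real.sqrt_sq (by linarith)

/-- Registered stub `stub_excessInstability` of the line «Coercivity» (RobustDefectLimitWindows, stmt-31280): a
`κ`-excess on all large cubes is removal-unstable in a μGSC of density `> 5/4`.
[cite: Suto2006, §2 (μGSC removal test)] -/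
theorem stub_excessInstability : ∀ e : ℝ, ∀ Y : Set (EuclideanSpace ℝ (Fin 3)), Literature.MathematicalPhysics.StatisticalMechanics.UniformlyDiscrete Y → Literature.MathematicalPhysics.StatisticalMechanics.IsMuGSC Literature.MathematicalPhysics.StatisticalMechanics.lennardJones e Y → (∃ ℓ₀ : ℝ, ∀ ℓ : ℝ, ∀ c : EuclideanSpace ℝ (Fin 3), ℓ₀ ≤ ℓ → 5 / 4 * ℓ ^ 3 < ((Y ∩ {z | ∀ i : Fin 3, c i ≤ z i ∧ z i < c i + ℓ}).ncard : ℝ)) → ∀ κ : ℝ, 0 < κ → ¬ (∃ ℓ₀ : ℝ, ∀ ℓ : ℝ, ∀ c : EuclideanSpace ℝ (Fin 3), ℓ₀ ≤ ℓ → ∀ F : Finset (EuclideanSpace ℝ (Fin 3)), (↑F : Set (EuclideanSpace ℝ (Fin 3))) = Y ∩ {z | ∀ i : Fin 3, c i ≤ z i ∧ z i < c i + ℓ} → (e + κ) * (F.card : ℝ) ≤ 1 / 2 * (∑ y ∈ F, ∑ w ∈ F, Literature.MathematicalPhysics.StatisticalMechanics.lennardJones (dist y w))) := by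
  intro e Y hUD hμ hlow κ hκ hexc
  obtain ⟨ℓ₁, hℓ₁⟩ := hlow
  obtain ⟨ℓ₂, hℓ₂⟩ := hexc
  obtain ⟨ℓ₃, hℓ₃⟩ := stub_crossTermSmall Y hUD κ hκ
  set ℓ : ℝ := max (max ℓ₁ ℓ₂) (max ℓ₃ 1) with hℓdef
  have h1 : ℓ₁ ≤ ℓ := (le_max_left _ _).trans (le_max_left _ _)
  have h2 : ℓ₂ ≤ ℓ := (le_max_right _ _).trans (le_max_left _ _)
  have h3 : ℓ₃ ≤ ℓ := (le_max_left _ _).trans (le_max_right _ _)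
  have hℓ1 : 1 ≤ ℓ := (le_max_right _ _).trans (le_max_right _ _)
  have hℓ0 : 0 < ℓ := by linarith
  set c : EuclideanSpace ℝ (Fin 3) := 0 with hc
  have hfin := finite_inter_cube hUD c hℓ0.le
  have hF : (↑hfin.toFinset : Set (EuclideanSpace ℝ (Fin 3))) = Y ∩ {z | ∀ i : Fin 3, c i ≤ z i ∧ z i < c i + ℓ} :=
    hfin.coe_toFinset
  have hFY : (↑hfin.toFinset : Set (EuclideanSpace ℝ (Fin 3))) ⊆ Y := by
    rw [hF]; exact Set.inter_subset_left
  have hcard : ((Y ∩ {z | ∀ i : Fin 3, c i ≤ z i ∧ z i < c i + ℓ}).ncard : ℝ) = hfin.toFinset.card := by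
    rw [Set.ncard_eq_toFinset_card _ hfin]
  have hlowℓ := hℓ₁ ℓ c h1
  rw [hcard] at hlowℓ
  have hexcℓ := hℓ₂ ℓ c h2 hfin.toFinset hF
  have hX := hℓ₃ ℓ c h3 hfin.toFinset hF
  have hrem := stub_removalUpperBound e Y hUD hμ hfin.toFinset hFY
  have hXle := (abs_le.1 hX).1
  have hℓ3 : 0 < ℓ ^ 3 := by positivity
  have hk := mul_lt_mul_of_pos_left hlowℓ hκ
  nlinarith [hexcℓ, hrem, hXle, hk, mul_pos hκ hℓ3]

end Summit.AtomisticToContinuum.Crystallization.Theorems.OverbindingBudgetExcessInstability
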